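import Summits.MatrixMultiplication.OmegaCensus.SmallFormats.MatMul22nRankGF7Slack6FlatMain
import HarnessLib

/-!
# ω-census family (a): `decide`-checked facts of the slack-6 search tables — bitmaps flag every table key (part 7 of 8)

Cell `pub-omega` (unit `pub-omega-tensor-g18`, `pub-omega-tensor-g19`), topic `Summits/MatrixMultiplication/OmegaCensus` (sub-folder `SmallFormats`).
Framing (verbatim): lottery ticket; floor = certified bounds/negative ranges. HONEST FRAMING: machine-generated kernel checks
(`pub-omega-tensor-g19/code/py/gen6_keyfacts19.py`, from tensor g18's generator; replaces tensor g17's `…SearchFacts5`, whose single file exceeded the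
gate's 600 s): the classes listed under their level-1 need key (`clsFacts6`). Each fact is decided on the FLAT accessors (`MatMul22nRankGF7Slack6Flat1…7`, `…Slack6FlatMain`) with the linear quantifier
`allUpTo` and transported to the landed tables by the proved equalities `…F_eq`; the eight files are independent of one another (the per-level
`∀` statements `bmKeys6_L` are glued in `MatMul22nRankGF7Slack6SearchFinal`; levels with one part state theirs here). Consumed by `bm6_of_table` / `search6_sound` in
`MatMul22nRankGF7Slack6SearchFinal`. Nothing here is progress on `ω`.
-/

namespace Summit.MatrixMultiplication.OmegaCensus.SmallFormats

set_option Elab.async false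

set_option maxRecDepth 100000 in
set_option maxHeartbeats 400000000 in
/-- Flat accessors, Boolean form: every class is listed under its level-1 need key. -/
theorem clsFactsB6F : (allUpTo 3692 fun c => decide (goff6F 1 (needKey6 1 (repW6Fl c)) < goff6F 1 (needKey6 1 (repW6Fl c) + 1)) &&
    anyUpTo 8 fun i => decide (i < nkoff6F (goff6F 1 (needKey6 1 (repW6Fl c)) + 1) - nkoff6F (goff6F 1 (needKey6 1 (repW6Fl c)))) &&
      (clsByNeed6F (nkoff6F (goff6F 1 (needKey6 1 (repW6Fl c))) + i) == c)) = true := by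
  decide +kernel

/-- The same on the landed accessors. -/
theorem clsFactsB6 : (allUpTo 3692 fun c => decide (goff6 1 (needKey6 1 (repW6 c)) < goff6 1 (needKey6 1 (repW6 c) + 1)) &&
    anyUpTo 8 fun i => decide (i < nkoff6 (goff6 1 (needKey6 1 (repW6 c)) + 1) - nkoff6 (goff6 1 (needKey6 1 (repW6 c)))) &&
      (clsByNeed6 (nkoff6 (goff6 1 (needKey6 1 (repW6 c))) + i) == c)) = true := by
  simpa only [goff6F_eq, repW6Fl_eq, nkoff6F_eq, clsByNeed6F_eq] using clsFactsB6F

/-- **Every class is listed under its level-1 need key** (`clsByNeed6` / `nkoff6`): the key is a level-1 table key (nonempty group) and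
`c` occurs among the at most 8 classes of that key. -/
theorem clsFacts6 : ∀ c < 3692, goff6 1 (needKey6 1 (repW6 c)) < goff6 1 (needKey6 1 (repW6 c) + 1) ∧
    ∃ i < 8, i < nkoff6 (goff6 1 (needKey6 1 (repW6 c)) + 1) - nkoff6 (goff6 1 (needKey6 1 (repW6 c))) ∧ clsByNeed6 (nkoff6 (goff6 1 (needKey6 1 (repW6 c))) + i) = c := by
  intro c hc
  have h := allUpTo_sound clsFactsB6 c hc
  rw [Bool.and_eq_true, decide_eq_true_eq] at h
  obtain ⟨i, hi, h2⟩ := anyUpTo_sound h.2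
  rw [Bool.and_eq_true, decide_eq_true_eq, beq_iff_eq] at h2
  exact ⟨h.1, i, hi, h2.1, h2.2⟩

end Summit.MatrixMultiplication.OmegaCensus.SmallFormats
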